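import Literature.Analysis.ValidatedNumerics.ParametricVertexCertificate
import Literature.Analysis.ValidatedNumerics.BoxCover
import Literature.LinearAlgebra.Matrix.LyapunovDecayRate
import HarnessLib

/-!
# Piecewise-Lyapunov certificates: `Re μ ≤ −r` for every eigenvalue of an affine family `J(p)` on a box

Topic `Literature/Analysis/ValidatedNumerics`. The kernel-checkable certificate behind the S3
(«Lyapunov shape») output of the certnum eigen-margin call when the parameter box is COVERED BY LEAVES,
EACH WITH ITS OWN Lyapunov matrix (design note `run/shared/lean/pub/certnum/sdp/DESIGN-eigopt.md` §1 S3;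
this lifts the «one common quadratic `P` for the whole box» restriction of the v0 shape, which is
sufficient only and fails on wide boxes).

Data: a real affine family `J(p) = J₀ + Σ_{k<K} p_k J^{(k)}` (rational `n × n` tables, NOT symmetric), a
box, a claimed rate `r`, and a kd-tree (`BoxCover.KdCert`) whose leaves carry `⟨P, π, cP, cN, vb⟩`: a
rational symmetric `P`, a bound `π`, an `LDLCert` `cP` for `P ⪰ κ·1` with `κ = cP.lam > 0`, an `LDLCert`
`cN` for `−P ⪰ −π·1`, and a vertex bundle `vb` (file `ParametricVertexCertificate.lean`) for the
SYMMETRIC affine family `Q_P(p) = −(J(p)ᵀP + PJ(p)) = Q₀ + Σ p_k Q^{(k)}`, whose exact tables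
`Q₀ = −(J₀ᵀP + PJ₀)`, `Q^{(k)} = −(J^{(k)ᵀ}P + PJ^{(k)})` the checker computes itself (`lyapTabs`). The leaf
check `lyapLeafOK` = these four certificates on the leaf box + `2·π·r ≤ vb.lam`, `0 ≤ vb.lam`, `0 < π`.

SOUNDNESS (`re_le_neg_of_kdCheck_lyap`): if `KdCert.check (lyapLeafOK n K J0 Js r) B t = true` then for
every point `x` of the box `B` and every complex eigenvalue `μ` of `J(x)`: `Re μ ≤ −r` (so `J(x)` is
Hurwitz on the whole box when `r > 0`, `forall_re_neg_of_kdCheck_lyap`). Per leaf this is exactly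
`Literature.LinearAlgebra.Matrix.re_le_neg_div_of_real_lyapunov_form_bounds` (Carlson–Schneider identity
at an eigenvector: `P ≻ O`, `yᵀPy ≤ π yᵀy`, `m yᵀy ≤ −yᵀ(JᵀP + PJ)y` ⇒ `Re μ ≤ −m/(2π)`) fed by the
vertex bundle of `Q_P` on the leaf box (Hladík's vertex property, `form_ge_on_box_of_checkVertexBundle`);
the box-to-leaves step is `KdCert.sound`. The statement is POINTWISE in `p` («every `J(p)` is
Hurwitz with rate `r`»), which is why different leaves may use different `P` — no common Lyapunov
function is claimed or needed. Nothing here is new mathematics; it is certificate plumbing.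

## What is NOT certified

Anything off the box; stability of a time-VARYING or nonlinear system `ẋ = J(p(t))x` (a pointwise
Hurwitz family is NOT a common-Lyapunov / LDI statement — that is the v0 single-`P` shape); instability
where the tree fails; any relation between `J(p)` and a device it linearises (client's rider).

## References

* [CarlsonSchneider1962] D. Carlson, H. Schneider, J. Math. Anal. Appl. 6 (1963) 430–446, § 1 — the
  identity at an eigenvector and Lyapunov's theorem, as packaged in `LyapunovDecayRate.lean`.
  [cite: CarlsonSchneider1962, § 1]
* [Hladik2017] M. Hladík, arXiv:1704.05782 (2017), Thm. 7 — vertex property of the affine symmetric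
  family `Q_P(p)`, as packaged in `ParametricVertexCertificate.lean`. [cite: Hladik2017, Thm. 7]
-/

open Finset Matrix

namespace Literature.Analysis.ValidatedNumerics

open ParametricIntervalPosSemidef ParametricEigenMargin

/-! ### Data and checker -/

/-- The exact table of `−(JᵀP + PJ)` for rational `n × n` tables `J`, `P`.
[cite: CarlsonSchneider1962, § 1 (the Lyapunov form)] -/
def lyapTab (n : ℕ) (J P : List (List ℚ)) : List (List ℚ) :=
  mtab n n fun i j ↦ -(rsum n fun l ↦ mget J l i * mget P l j + mget P i l * mget J l j)

/-- The tables of the symmetric affine family `Q_P(p) = −(J(p)ᵀP + PJ(p))`: constant part `−(J₀ᵀP + PJ₀)`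
and, per parameter, `−(J^{(k)ᵀ}P + PJ^{(k)})`. [cite: CarlsonSchneider1962, § 1 (the Lyapunov form)] -/
def lyapTabs (n K : ℕ) (J0 : List (List ℚ)) (Js : List (List (List ℚ))) (P : List (List ℚ)) :
    List (List ℚ) × List (List (List ℚ)) :=
  (lyapTab n J0 P, vtab K fun k ↦ lyapTab n (Js.getD k []) P)

/-- A Lyapunov leaf: the leaf's own Lyapunov matrix `P`, a bound `π ≥ λ_max(P)`, certificates for
`P ⪰ cP.lam·1` and `−P ⪰ cN.lam·1` (`cN.lam ≥ −π`), and the vertex bundle of `Q_P` on the leaf box.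
[cite: CarlsonSchneider1962, § 1] -/
structure LyapLeaf where
  /-- the Lyapunov matrix of this leaf (rational, symmetric) -/
  P : List (List ℚ)
  /-- claimed upper bound of `λ_max(P)` -/
  π : ℚ
  /-- certificate `P ⪰ cP.lam · 1` (need `cP.lam > 0`) -/
  cP : LDLCert
  /-- certificate `−P ⪰ cN.lam · 1` (need `cN.lam ≥ −π`) -/
  cN : LDLCert
  /-- vertex bundle of `Q_P(p) = −(J(p)ᵀP + PJ(p))` on the leaf box (claim `vb.lam`) -/
  vb : VertexBundle
  deriving Inhabited

/-- Lower ends of a `Box` as a list. [folklore] -/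
def boxLoList (B : Box) : List ℚ := B.map Prod.fst

/-- Upper ends of a `Box` as a list. [folklore] -/
def boxHiList (B : Box) : List ℚ := B.map Prod.snd

/-- **The Lyapunov leaf check** for the rate claim `r` on the leaf box `B`: `P` symmetric, `cP.lam > 0`
and `checkLower n P 0 cP`, `0 < π`, `−π ≤ cN.lam` and `checkLower n (−P) 0 cN`, `0 ≤ vb.lam`,
`2·π·r ≤ vb.lam`, and the vertex bundle of `Q_P` checks on `[boxLoList B, boxHiList B]`.
[cite: CarlsonSchneider1962, § 1; Hladik2017, Thm. 7] -/
def lyapLeafOK (n K : ℕ) (J0 : List (List ℚ)) (Js : List (List (List ℚ))) (r : ℚ) (B : Box)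
    (l : LyapLeaf) : Bool :=
  symmQ n l.P && decide (0 < l.cP.lam) && checkLower n l.P (zeroTab n) l.cP && decide (0 < l.π) &&
    decide (-l.π ≤ l.cN.lam) && checkLower n (negTab n l.P) (zeroTab n) l.cN && decide (0 ≤ l.vb.lam) &&
    decide (2 * l.π * r ≤ l.vb.lam) &&
    checkVertexBundle n K (lyapTabs n K J0 Js l.P).1 (lyapTabs n K J0 Js l.P).2 (boxLoList B) (boxHiList B) l.vb

/-! ### Plumbing -/

/-- Entries of `finMat` (plumbing). [folklore] -/
private theorem finMat_apply₄ (n : ℕ) (A : List (List ℚ)) (i j : Fin n) :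
    finMat n A i j = mreal A i j := rfl

/-- A symmetric table is a symmetric real matrix (same statement as the private lemma of
`ParametricVertexCertificate.lean`). [folklore] -/
private theorem isHermitian_finMat_of_symmQ' {n : ℕ} {A : List (List ℚ)} (h : symmQ n A = true) :
    (finMat n A).IsHermitian := by
  refine Matrix.IsHermitian.ext fun i j ↦ ?_
  have h1 := of_rall (of_rall h j.isLt) i.isLt
  rw [decide_eq_true_eq] at h1
  rw [star_trivial, finMat_apply₄, finMat_apply₄]
  unfold mreal; rw [h1]

/-- `finMat (−A) = −finMat A`. [folklore] -/
private theorem finMat_negTab' (n : ℕ) (A : List (List ℚ)) : finMat n (negTab n A) = -finMat n A := by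
  ext i j
  rw [Matrix.neg_apply, finMat_apply₄, finMat_apply₄]
  unfold negTab mreal
  rw [mget_mtab _ i.isLt j.isLt]; push_cast; ring

/-- Exact data: `|A i j − A i j| ≤ 0 = zeroTab i j`. [folklore] -/
private theorem abs_sub_self_le_zeroTab {n : ℕ} (A : Matrix (Fin n) (Fin n) ℝ) (C : List (List ℚ))
    (hA : A = finMat n C) (i j : Fin n) : |A i j - mreal C i j| ≤ mreal (zeroTab n) i j := by
  subst hA
  rw [finMat_apply₄, sub_self, abs_zero]
  unfold zeroTab mreal; rw [mget_mtab _ i.isLt j.isLt]; push_cast; exact le_rfl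

/-- The real Lyapunov form matrix `−(JᵀP + PJ)`. [cite: CarlsonSchneider1962, § 1] -/
private def lyapR {n : ℕ} (J P : Matrix (Fin n) (Fin n) ℝ) : Matrix (Fin n) (Fin n) ℝ := -(Jᵀ * P + P * J)

/-- `finMat (lyapTab J P) = −((finMat J)ᵀ · finMat P + finMat P · finMat J)`. [folklore] -/
private theorem finMat_lyapTab {n : ℕ} (J P : List (List ℚ)) :
    finMat n (lyapTab n J P) = lyapR (finMat n J) (finMat n P) := by
  ext i j
  unfold lyapR
  rw [Matrix.neg_apply, Matrix.add_apply, Matrix.mul_apply, Matrix.mul_apply, finMat_apply₄]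
  unfold lyapTab mreal
  rw [mget_mtab _ i.isLt j.isLt, rsum_eq_sum]
  push_cast
  rw [← Fin.sum_univ_eq_sum_range (fun l ↦ ((mget J l i : ℚ) : ℝ) * ((mget P l j : ℚ) : ℝ)
    + ((mget P i l : ℚ) : ℝ) * ((mget J l j : ℚ) : ℝ)) n, Finset.sum_add_distrib]
  rfl

/-- `lyapR` is affine in `J`: `Q_P(J₀ + Σ p_k J_k) = Q_P(J₀) + Σ p_k Q_P(J_k)`. [folklore] -/
private theorem lyapR_affine {n K : ℕ} (J0 : Matrix (Fin n) (Fin n) ℝ) (Jf : Fin K → Matrix (Fin n) (Fin n) ℝ)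
    (P : Matrix (Fin n) (Fin n) ℝ) (p : Fin K → ℝ) :
    lyapR (J0 + paramMatrix Jf p) P = lyapR J0 P + paramMatrix (fun k ↦ lyapR (Jf k) P) p := by
  unfold lyapR paramMatrix
  rw [Matrix.transpose_add, Matrix.transpose_sum, Matrix.add_mul, Matrix.sum_mul, Matrix.mul_add,
    Matrix.mul_sum]
  simp only [Matrix.transpose_smul, Matrix.smul_mul, Matrix.mul_smul, smul_neg, smul_add, neg_add,
    Finset.sum_add_distrib, Finset.sum_neg_distrib]
  abel

/-- The `k`-th parameter table of `lyapTabs`. [folklore] -/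
private theorem lyapTabs_snd_getD {n K : ℕ} (J0 : List (List ℚ)) (Js : List (List (List ℚ)))
    (P : List (List ℚ)) (k : Fin K) : (lyapTabs n K J0 Js P).2.getD k [] = lyapTab n (Js.getD k []) P := by
  show ((List.range K).map fun k ↦ lyapTab n (Js.getD k []) P).getD k [] = _
  rw [List.getD_eq_getElem (l := (List.range K).map _) (d := []) (by simp [k.isLt]),
    List.getElem_map, List.getElem_range]

/-- **The Q-family is the Lyapunov form of the J-family**: the real affine family of the tables
`lyapTabs` at `p` equals `−(J(p)ᵀP + PJ(p))`. [cite: CarlsonSchneider1962, § 1 (the Lyapunov form)] -/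
private theorem affine_lyapTabs_eq {n K : ℕ} (J0 : List (List ℚ)) (Js : List (List (List ℚ)))
    (P : List (List ℚ)) (p : Fin K → ℝ) :
    finMat n (lyapTabs n K J0 Js P).1
        + paramMatrix (fun k : Fin K ↦ finMat n ((lyapTabs n K J0 Js P).2.getD k [])) p
      = -((finMat n J0 + paramMatrix (fun k : Fin K ↦ finMat n (Js.getD k [])) p)ᵀ * finMat n P
          + finMat n P * (finMat n J0 + paramMatrix (fun k : Fin K ↦ finMat n (Js.getD k [])) p)) := by
  have h1 : (lyapTabs n K J0 Js P).1 = lyapTab n J0 P := rfl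
  simp only [h1, lyapTabs_snd_getD, finMat_lyapTab]
  rw [← lyapR_affine]; rfl

/-- Box ends as lists: `vreal (boxLoList B) k = (B.ivl k).1`, `vreal (boxHiList B) k = (B.ivl k).2`. [folklore] -/
private theorem vreal_boxLo_boxHi (B : Box) (k : ℕ) :
    vreal (boxLoList B) k = ((B.ivl k).1 : ℝ) ∧ vreal (boxHiList B) k = ((B.ivl k).2 : ℝ) := by
  unfold vreal vget boxLoList boxHiList Box.ivl
  refine ⟨?_, ?_⟩
  · rw [show (0 : ℚ) = Prod.fst ((0 : ℚ), (0 : ℚ)) from rfl, List.getD_map]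
  · rw [show (0 : ℚ) = Prod.snd ((0 : ℚ), (0 : ℚ)) from rfl, List.getD_map]

/-! ### Soundness -/

/-- **Per leaf**: an accepted Lyapunov leaf proves `Re μ ≤ −r` for every eigenvalue of `J(x)` at every
point `x` of the leaf box. [cite: CarlsonSchneider1962, § 1; Hladik2017, Thm. 7] -/
theorem re_le_neg_of_lyapLeafOK {n K : ℕ} {J0 : List (List ℚ)} {Js : List (List (List ℚ))} {r : ℚ}
    {B : Box} {l : LyapLeaf} (h : lyapLeafOK n K J0 Js r B l = true) (x : ℕ → ℝ) (hx : B.mem x)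
    {μ : ℂ} (hμ : μ ∈ spectrum ℂ ((finMat n J0
      + paramMatrix (fun k : Fin K ↦ finMat n (Js.getD k [])) (fun k : Fin K ↦ x k)).map (algebraMap ℝ ℂ))) :
    μ.re ≤ -(r : ℝ) := by
  unfold lyapLeafOK at h
  simp only [Bool.and_eq_true, decide_eq_true_eq] at h
  obtain ⟨⟨⟨⟨⟨⟨⟨⟨hsym, hκ⟩, hcP⟩, hπ⟩, hNπ⟩, hcN⟩, hlam0⟩, hrate⟩, hvb⟩ := h
  set J : Matrix (Fin n) (Fin n) ℝ :=
    finMat n J0 + paramMatrix (fun k : Fin K ↦ finMat n (Js.getD k [])) (fun k : Fin K ↦ x k) with hJ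
  set P : Matrix (Fin n) (Fin n) ℝ := finMat n l.P with hPdef
  have hPH : P.IsHermitian := isHermitian_finMat_of_symmQ' hsym
  -- P ≻ 0
  have hPpos : P.PosDef :=
    posDef_of_checkLower hcP hκ hPH (abs_sub_self_le_zeroTab P l.P rfl)
  -- yᵀPy ≤ π yᵀy
  have hPπ : ∀ y : Fin n → ℝ, y ⬝ᵥ (P *ᵥ y) ≤ (l.π : ℝ) * (y ⬝ᵥ y) := by
    intro y
    have h1 := mul_dotProduct_le_of_checkLower hcN
      (A := finMat n (negTab n l.P)) (abs_sub_self_le_zeroTab _ _ rfl) y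
    rw [finMat_negTab', Matrix.neg_mulVec, dotProduct_neg] at h1
    have hyy : 0 ≤ y ⬝ᵥ y := Finset.sum_nonneg fun i _ ↦ mul_self_nonneg (y i)
    have h2 : (-(l.π : ℝ)) * (y ⬝ᵥ y) ≤ (l.cN.lam : ℝ) * (y ⬝ᵥ y) :=
      mul_le_mul_of_nonneg_right (by exact_mod_cast hNπ) hyy
    linarith
  -- margin of the Lyapunov form on the leaf box (vertex bundle), at the point x
  have hp : (fun k : Fin K ↦ x k) ∈ Set.Icc (fun k : Fin K ↦ vreal (boxLoList B) k) (fun k : Fin K ↦ vreal (boxHiList B) k) := by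
    refine ⟨fun k ↦ ?_, fun k ↦ ?_⟩
    · show vreal (boxLoList B) k ≤ x k
      rw [(vreal_boxLo_boxHi B k).1]; exact (hx k).1
    · show x k ≤ vreal (boxHiList B) k
      rw [(vreal_boxLo_boxHi B k).2]; exact (hx k).2
  have hQ : ∀ y : Fin n → ℝ, (l.vb.lam : ℝ) * (y ⬝ᵥ y) ≤ -(y ⬝ᵥ ((Jᵀ * P + P * J) *ᵥ y)) := by
    intro y
    have h1 := form_ge_on_box_of_checkVertexBundle hvb hp y
    rw [affine_lyapTabs_eq, Matrix.neg_mulVec, dotProduct_neg] at h1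
    exact h1
  have hrate' : (r : ℝ) ≤ (l.vb.lam : ℝ) / (2 * (l.π : ℝ)) := by
    rw [le_div_iff₀ (by positivity)]
    have : ((2 * l.π * r : ℚ) : ℝ) ≤ (l.vb.lam : ℝ) := by exact_mod_cast hrate
    push_cast at this; linarith
  have hmain := Literature.LinearAlgebra.Matrix.re_le_neg_div_of_real_lyapunov_form_bounds
    (J := J) (P := P) (by exact_mod_cast hlam0) (by exact_mod_cast hπ) hPpos hPπ hQ hμ
  rw [neg_div] at hmain
  linarith

/-- **Piecewise-Lyapunov certificate, box level (END-TO-END).** If a kd-tree of Lyapunov leaves passes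
`KdCert.check (lyapLeafOK n K J0 Js r)` on the box `B`, then for EVERY point `x` of `B` every complex
eigenvalue `μ` of `J(x) = J₀ + Σ_k x_k J^{(k)}` satisfies `Re μ ≤ −r`. Different leaves may carry
different Lyapunov matrices — the conclusion is pointwise in `x`.
[cite: CarlsonSchneider1962, § 1; Hladik2017, Thm. 7] -/
theorem re_le_neg_of_kdCheck_lyap {n K : ℕ} {J0 : List (List ℚ)} {Js : List (List (List ℚ))} {r : ℚ}
    {B : Box} {t : KdCert LyapLeaf} (h : t.check (lyapLeafOK n K J0 Js r) B = true)
    (x : ℕ → ℝ) (hx : B.mem x) {μ : ℂ}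
    (hμ : μ ∈ spectrum ℂ ((finMat n J0
      + paramMatrix (fun k : Fin K ↦ finMat n (Js.getD k [])) (fun k : Fin K ↦ x k)).map (algebraMap ℝ ℂ))) :
    μ.re ≤ -(r : ℝ) :=
  KdCert.sound (P := fun x ↦ ∀ μ : ℂ, μ ∈ spectrum ℂ ((finMat n J0
      + paramMatrix (fun k : Fin K ↦ finMat n (Js.getD k [])) (fun k : Fin K ↦ x k)).map (algebraMap ℝ ℂ)) →
      μ.re ≤ -(r : ℝ))
    (fun _ _ hl x hx _ hμ ↦ re_le_neg_of_lyapLeafOK hl x hx hμ) t B h x hx μ hμ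

/-- **Hurwitz on the whole box** from a piecewise-Lyapunov certificate with a positive rate claim.
[cite: CarlsonSchneider1962, § 1; Hladik2017, Thm. 7] -/
theorem forall_re_neg_of_kdCheck_lyap {n K : ℕ} {J0 : List (List ℚ)} {Js : List (List (List ℚ))} {r : ℚ}
    (hr : 0 < r) {B : Box} {t : KdCert LyapLeaf} (h : t.check (lyapLeafOK n K J0 Js r) B = true)
    (x : ℕ → ℝ) (hx : B.mem x) {μ : ℂ}
    (hμ : μ ∈ spectrum ℂ ((finMat n J0
      + paramMatrix (fun k : Fin K ↦ finMat n (Js.getD k [])) (fun k : Fin K ↦ x k)).map (algebraMap ℝ ℂ))) :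
    μ.re < 0 :=
  (re_le_neg_of_kdCheck_lyap h x hx hμ).trans_lt (by exact_mod_cast neg_neg_of_pos hr)


/-! ### Shifted families: certifying `Re μ ≤ −(s + r)` by checking `J(p) + s·1`

A rate request is best certified by SHIFTING: `Re μ ≤ −s` for every eigenvalue of `J(p)` iff
`J(p) + s·1` is Hurwitz; the kd certificate is then produced for the tables `(J₀ + s·1, J^{(k)})`. -/

/-- The table `J + s·1`. [folklore] -/
def addDiagTab (n : ℕ) (s : ℚ) (J : List (List ℚ)) : List (List ℚ) :=
  mtab n n fun i j ↦ mget J i j + if i = j then s else 0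

/-- `finMat (J + s·1) = finMat J + s • 1`. [folklore] -/
private theorem finMat_addDiagTab (n : ℕ) (s : ℚ) (J : List (List ℚ)) :
    finMat n (addDiagTab n s J) = finMat n J + (s : ℝ) • (1 : Matrix (Fin n) (Fin n) ℝ) := by
  ext i j
  rw [Matrix.add_apply, Matrix.smul_apply, finMat_apply₄, finMat_apply₄, Matrix.one_apply, smul_eq_mul]
  unfold addDiagTab mreal
  rw [mget_mtab _ i.isLt j.isLt]
  by_cases h : i = j
  · subst h; simp
  · have h' : (i : ℕ) ≠ (j : ℕ) := fun e ↦ h (Fin.ext e)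
    simp [h, h']

/-- **Shifted piecewise-Lyapunov certificate**: if the kd-tree checks for the SHIFTED tables
`(J₀ + s·1, J^{(k)})` with rate `r`, then every eigenvalue `μ` of the UNSHIFTED `J(x)`, `x` in the box,
has `Re μ ≤ −(s + r)` (since `μ + s` is an eigenvalue of `J(x) + s·1`).
[cite: CarlsonSchneider1962, § 1; Hladik2017, Thm. 7] -/
theorem re_le_neg_of_kdCheck_lyap_shifted {n K : ℕ} {J0 : List (List ℚ)} {Js : List (List (List ℚ))}
    {s r : ℚ} {B : Box} {t : KdCert LyapLeaf}
    (h : t.check (lyapLeafOK n K (addDiagTab n s J0) Js r) B = true) (x : ℕ → ℝ) (hx : B.mem x) {μ : ℂ}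
    (hμ : μ ∈ spectrum ℂ ((finMat n J0
      + paramMatrix (fun k : Fin K ↦ finMat n (Js.getD k [])) (fun k : Fin K ↦ x k)).map (algebraMap ℝ ℂ))) :
    μ.re ≤ -((s + r : ℚ) : ℝ) := by
  set M : Matrix (Fin n) (Fin n) ℝ :=
    finMat n J0 + paramMatrix (fun k : Fin K ↦ finMat n (Js.getD k [])) (fun k : Fin K ↦ x k) with hM
  -- the shifted real family is `M + s • 1`
  have hshift : finMat n (addDiagTab n s J0)
      + paramMatrix (fun k : Fin K ↦ finMat n (Js.getD k [])) (fun k : Fin K ↦ x k) = M + (s : ℝ) • 1 := by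
    rw [finMat_addDiagTab, hM]; abel
  -- its complexification is `algebraMap ℂ _ s + M.map`
  have hmap : (M + (s : ℝ) • (1 : Matrix (Fin n) (Fin n) ℝ)).map (algebraMap ℝ ℂ)
      = algebraMap ℂ (Matrix (Fin n) (Fin n) ℂ) (s : ℂ) + M.map (algebraMap ℝ ℂ) := by
    rw [Matrix.map_add (algebraMap ℝ ℂ) (map_add _), Algebra.algebraMap_eq_smul_one, add_comm]
    congr 1
    ext i j
    simp only [Matrix.map_apply, Matrix.smul_apply, Matrix.one_apply, smul_eq_mul, mul_ite, mul_one,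
      mul_zero]
    split_ifs <;> simp [Complex.coe_algebraMap]
  have hμ' : (s : ℂ) + μ ∈ spectrum ℂ ((finMat n (addDiagTab n s J0)
      + paramMatrix (fun k : Fin K ↦ finMat n (Js.getD k [])) (fun k : Fin K ↦ x k)).map (algebraMap ℝ ℂ)) := by
    rw [hshift, hmap, ← spectrum.singleton_add_eq]
    exact Set.add_mem_add (Set.mem_singleton _) hμ
  have h1 := re_le_neg_of_kdCheck_lyap h x hx hμ'
  simp only [Complex.add_re, Complex.ratCast_re] at h1
  push_cast
  linarith

/-- **Uniform decay rate `s` on the box, Hurwitz form**: under the shifted check with `r ≥ 0` and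
`s > 0`, every eigenvalue of `J(x)` has `Re μ ≤ −s < 0`. [cite: CarlsonSchneider1962, § 1; Hladik2017, Thm. 7] -/
theorem re_le_neg_shift_of_kdCheck_lyap_shifted {n K : ℕ} {J0 : List (List ℚ)} {Js : List (List (List ℚ))}
    {s r : ℚ} (hr : 0 ≤ r) {B : Box} {t : KdCert LyapLeaf}
    (h : t.check (lyapLeafOK n K (addDiagTab n s J0) Js r) B = true) (x : ℕ → ℝ) (hx : B.mem x) {μ : ℂ}
    (hμ : μ ∈ spectrum ℂ ((finMat n J0
      + paramMatrix (fun k : Fin K ↦ finMat n (Js.getD k [])) (fun k : Fin K ↦ x k)).map (algebraMap ℝ ℂ))) :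
    μ.re ≤ -(s : ℝ) :=
  (re_le_neg_of_kdCheck_lyap_shifted h x hx hμ).trans (by push_cast; linarith [(Rat.cast_nonneg.2 hr : (0:ℝ) ≤ r)])

/-! ### Kernel example -/

/-- `J(p) = [[−1, p], [0, −1]]`, `p ∈ [−1, 1]`, ONE leaf with `P = I`, `π = 1`, rate `r = 1/4`:
`Q_I(p) = −(Jᵀ + J) = [[2, −p], [−p, 2]]`, corner tables `[[2, ∓1], [∓1, 2]]` pass Gershgorin with claim
`1/2 = 2·π·r`; `P = I ⪰ 1·1` and `−I ⪰ −1·1` pass with empty factors. -/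
example : KdCert.check (lyapLeafOK 2 1 [[-1, 0], [0, -1]] [[[0, 1], [0, 0]]] (1/4)) [((-1 : ℚ), 1)]
    (KdCert.leaf ⟨[[1, 0], [0, 1]], 1, ⟨1, 0, [], []⟩, ⟨-1, 0, [], []⟩,
      ⟨1/2, [⟨1/2, 0, [], []⟩, ⟨1/2, 0, [], []⟩]⟩⟩) = true := by
  decide +kernel


/-! ### Diagonal similarity: certifying `J(p)` through the balanced tables `D·J(p)·D⁻¹`

Appended 2026-08-27 (session 3): the emitter conditions the Lyapunov certificates by an exact positive
diagonal scaling `D` (Osborne balancing, e.g. swing models with `ω₀ = 377` in one entry); the kd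
certificate is then produced for the tables `D J₀ D⁻¹`, `D J^{(k)} D⁻¹`. Since `D J(p) D⁻¹` is similar to
`J(p)` for every `p`, the rate bound transfers to the ORIGINAL family (`spectrum.units_conjugate`). -/

/-- The table `D·J·D⁻¹` for `D = diag(d)`: entry `d_i · J_ij / d_j`. [folklore] -/
def conjDiagTab (n : ℕ) (d : List ℚ) (J : List (List ℚ)) : List (List ℚ) :=
  mtab n n fun i j ↦ vget d i * mget J i j / vget d j

/-- All scaling factors positive (so `D` is invertible). [folklore] -/
def posListQ (n : ℕ) (d : List ℚ) : Bool := rall n fun i ↦ decide (0 < vget d i)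

/-- `finMat (D·J·D⁻¹) = diag(d) · finMat J · diag(d⁻¹)` (real matrices). [folklore] -/
private theorem finMat_conjDiagTab {n : ℕ} (d : List ℚ) (J : List (List ℚ)) :
    finMat n (conjDiagTab n d J)
      = Matrix.diagonal (fun i : Fin n ↦ (vreal d i)) * finMat n J
          * Matrix.diagonal (fun i : Fin n ↦ (vreal d i)⁻¹) := by
  ext i j
  rw [Matrix.mul_diagonal, Matrix.diagonal_mul, finMat_apply₄, finMat_apply₄]
  unfold conjDiagTab mreal vreal
  rw [mget_mtab _ i.isLt j.isLt]; push_cast; ring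

/-- The balanced affine family is the conjugate of the original one:
`D J₀ D⁻¹ + Σ x_k D J^{(k)} D⁻¹ = D (J₀ + Σ x_k J^{(k)}) D⁻¹`. [folklore] -/
private theorem affine_conjDiagTab_eq {n K : ℕ} (d : List ℚ) (J0 : List (List ℚ))
    (Js : List (List (List ℚ))) (x : ℕ → ℝ) :
    finMat n (conjDiagTab n d J0)
        + paramMatrix (fun k : Fin K ↦ finMat n ((vtab K fun k ↦ conjDiagTab n d (Js.getD k [])).getD k []))
            (fun k : Fin K ↦ x k)
      = Matrix.diagonal (fun i : Fin n ↦ (vreal d i))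
          * (finMat n J0 + paramMatrix (fun k : Fin K ↦ finMat n (Js.getD k [])) (fun k : Fin K ↦ x k))
          * Matrix.diagonal (fun i : Fin n ↦ (vreal d i)⁻¹) := by
  have h2 : ∀ k : Fin K, (vtab K fun k ↦ conjDiagTab n d (Js.getD k [])).getD k [] = conjDiagTab n d (Js.getD k []) :=
    fun k ↦ by
      show ((List.range K).map fun k ↦ conjDiagTab n d (Js.getD k [])).getD k [] = _
      rw [List.getD_eq_getElem (l := (List.range K).map _) (d := []) (by simp [k.isLt]),
        List.getElem_map, List.getElem_range]
  simp only [h2, finMat_conjDiagTab]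
  unfold paramMatrix
  rw [Matrix.mul_add, Matrix.add_mul, Matrix.mul_sum, Matrix.sum_mul]
  congr 1
  refine Finset.sum_congr rfl fun k _ ↦ ?_
  rw [Matrix.mul_smul, Matrix.smul_mul]

/-- **Balanced + shifted piecewise-Lyapunov certificate ⇒ rate bound for the ORIGINAL family.** If all
scaling factors are positive and the kd-tree checks for the tables `(D J₀ D⁻¹ + s·1, D J^{(k)} D⁻¹)` with
rate `r`, then every eigenvalue `μ` of `J(x) = J₀ + Σ x_k J^{(k)}`, `x` in the box, has `Re μ ≤ −(s + r)`.
[cite: CarlsonSchneider1962, § 1; Hladik2017, Thm. 7] -/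
theorem re_le_neg_of_kdCheck_lyap_conj_shifted {n K : ℕ} {J0 : List (List ℚ)}
    {Js : List (List (List ℚ))} {d : List ℚ} {s r : ℚ} {B : Box} {t : KdCert LyapLeaf}
    (hd : posListQ n d = true)
    (h : t.check (lyapLeafOK n K (addDiagTab n s (conjDiagTab n d J0))
      (vtab K fun k ↦ conjDiagTab n d (Js.getD k [])) r) B = true)
    (x : ℕ → ℝ) (hx : B.mem x) {μ : ℂ}
    (hμ : μ ∈ spectrum ℂ ((finMat n J0
      + paramMatrix (fun k : Fin K ↦ finMat n (Js.getD k [])) (fun k : Fin K ↦ x k)).map (algebraMap ℝ ℂ))) :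
    μ.re ≤ -((s + r : ℚ) : ℝ) := by
  set M : Matrix (Fin n) (Fin n) ℝ :=
    finMat n J0 + paramMatrix (fun k : Fin K ↦ finMat n (Js.getD k [])) (fun k : Fin K ↦ x k) with hM
  -- the complex diagonal unit
  have hdpos : ∀ i : Fin n, (0 : ℝ) < vreal d i := fun i ↦ by
    have := of_rall hd i.isLt; rw [decide_eq_true_eq] at this
    unfold vreal; exact_mod_cast this
  let dc : Fin n → ℂ := fun i ↦ ((vreal d i : ℝ) : ℂ)
  have hdc : ∀ i, dc i ≠ 0 := fun i ↦ by
    simp only [dc, ne_eq, Complex.ofReal_eq_zero]; exact (hdpos i).ne'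
  let u : (Matrix (Fin n) (Fin n) ℂ)ˣ :=
    ⟨Matrix.diagonal dc, Matrix.diagonal fun i ↦ (dc i)⁻¹,
      by rw [Matrix.diagonal_mul_diagonal]; convert Matrix.diagonal_one with i; exact mul_inv_cancel₀ (hdc i),
      by rw [Matrix.diagonal_mul_diagonal]; convert Matrix.diagonal_one with i; exact inv_mul_cancel₀ (hdc i)⟩
  -- the balanced family, complexified, is u * M.map * u⁻¹
  have hconj : (finMat n (conjDiagTab n d J0)
        + paramMatrix (fun k : Fin K ↦ finMat n ((vtab K fun k ↦ conjDiagTab n d (Js.getD k [])).getD k []))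
            (fun k : Fin K ↦ x k)).map (algebraMap ℝ ℂ)
      = (u : Matrix (Fin n) (Fin n) ℂ) * M.map (algebraMap ℝ ℂ) * (u⁻¹ : (Matrix (Fin n) (Fin n) ℂ)ˣ) := by
    rw [affine_conjDiagTab_eq, ← hM, Matrix.map_mul, Matrix.map_mul]
    have e1 : (Matrix.diagonal fun i : Fin n ↦ vreal d i).map (algebraMap ℝ ℂ) = Matrix.diagonal dc :=
      Matrix.diagonal_map (map_zero _)
    have e2 : (Matrix.diagonal fun i : Fin n ↦ (vreal d i)⁻¹).map (algebraMap ℝ ℂ)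
        = Matrix.diagonal fun i ↦ (dc i)⁻¹ := by
      rw [Matrix.diagonal_map (map_zero _)]
      congr 1; funext i; simp [dc, Complex.coe_algebraMap]
    rw [e1, e2]; rfl
  have hμ' : μ ∈ spectrum ℂ ((finMat n (conjDiagTab n d J0)
        + paramMatrix (fun k : Fin K ↦ finMat n ((vtab K fun k ↦ conjDiagTab n d (Js.getD k [])).getD k []))
            (fun k : Fin K ↦ x k)).map (algebraMap ℝ ℂ)) := by
    rw [hconj, spectrum.units_conjugate]; exact hμ
  exact re_le_neg_of_kdCheck_lyap_shifted h x hx hμ'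

end Literature.Analysis.ValidatedNumerics
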